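import Literature.MathematicalPhysics.QuantumLattice.YangMillsClassical
import Literature.MathematicalPhysics.QuantumLattice.GrassmannIntegralWilsonProofs
import HarnessLib

/-!
# Crux `NT` (stmt-QuantumFields-19353): the one-link Wilson cost — definitions and Frobenius bookkeeping

Fleet lead prover of crux `NT` (unit `ym-spine-19353-p1`, g9); route-posited objects of the one-link EQUIPARTITION FLOOR
(`Theorems/BalabanLadderNTLinkEquipartition.lean`) for a compact group `G` with a continuous unitary representation
`ρ : G →* M_N(ℂ)`:

* `reIP X Y = Re tr(Yᴴ X)` — the real Hilbert–Schmidt pairing of complex matrices, with `‖X‖_F² = ⟨X, X⟩`,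
  `‖X + Y‖² = ‖X‖² + ‖Y‖² + 2⟨X, Y⟩`, the weighted polarisation bound `2|⟨X, Y⟩| ≤ s‖X‖² + s⁻¹‖Y‖²`, the discrete
  Cauchy–Schwarz `‖Σ V_i‖² ≤ m Σ ‖V_i‖²`, and the two-sided PINCH `sum_normSq_pinch` of `Σ_i ‖A − P_i‖²` around any base
  point `A₀` (`(m/2)‖A − A₀‖² ≤ Σ‖A − P_i‖² + Σ‖A₀ − P_i‖²`, `Σ‖A − P_i‖² ≤ 2m‖A − A₀‖² + 2Σ‖A₀ − P_i‖²`);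
* `linkCost ρ k h = Σ_i (N − Re tr ρ(h k_i))` — the one-link Wilson cost of the link variable `h` against a finite family of
  staples `k : ι → G` (every plaquette through a link contributes `N − Re tr ρ(U_p)` with `U_p = h · k_p` up to cyclic order),
  `= ½ Σ_i ‖ρ h − ρ(k_i⁻¹)‖_F²` (`linkCost_eq_half_sum_normSq`), non-negative, continuous, attaining its minimum, and pinched:
  `(m/4) r² − u₀ ≤ linkCost ρ k h ≤ m r² + 2u₀` with `r = ‖ρ h − ρ g₀‖_F`, `u₀ = linkCost ρ k g₀` (`linkCost_pinch`).

Nothing here is asserted about Yang–Mills; elementary matrix algebra in the tree's Frobenius vocabulary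
(`Matrix.frobenius_norm_sq_eq_re_trace`).  Refs: Horn–Johnson 2013 (0.2.5), Thm. 2.2.2.
-/

set_option autoImplicit false

noncomputable section

open scoped Matrix Matrix.Norms.Frobenius BigOperators
open Literature.MathematicalPhysics.QuantumLattice (unitaryRep_inv_eq_conjTranspose)

namespace Summit.QuantumFields.YangMills.Cruxes.NT.LinkEquipartition

/-! ## §1 Frobenius bookkeeping -/

section Frobenius

variable {N : ℕ}

/-- The real Hilbert–Schmidt pairing `⟨X, Y⟩ = Re tr(Yᴴ X)` of two complex matrices. [folklore] -/
def reIP (X Y : Matrix (Fin N) (Fin N) ℂ) : ℝ := ((Yᴴ * X).trace).re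

/-- `‖X‖_F² = ⟨X, X⟩`. [folklore] -/
theorem normSq_eq_reIP (X : Matrix (Fin N) (Fin N) ℂ) : ‖X‖ ^ 2 = reIP X X := by
  rw [reIP, Matrix.frobenius_norm_sq_eq_re_trace]; rfl

/-- The pairing is symmetric. [folklore] -/
theorem reIP_comm (X Y : Matrix (Fin N) (Fin N) ℂ) : reIP X Y = reIP Y X := by
  have h : (Xᴴ * Y) = (Yᴴ * X)ᴴ := by rw [Matrix.conjTranspose_mul, Matrix.conjTranspose_conjTranspose]
  rw [reIP, reIP, h, Matrix.trace_conjTranspose, Complex.star_def, Complex.conj_re]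

/-- `⟨X + X', Y⟩ = ⟨X, Y⟩ + ⟨X', Y⟩`. [folklore] -/
theorem reIP_add_left (X X' Y : Matrix (Fin N) (Fin N) ℂ) : reIP (X + X') Y = reIP X Y + reIP X' Y := by
  simp only [reIP, Matrix.mul_add, Matrix.trace_add, Complex.add_re]

/-- `⟨X, Y + Y'⟩ = ⟨X, Y⟩ + ⟨X, Y'⟩`. [folklore] -/
theorem reIP_add_right (X Y Y' : Matrix (Fin N) (Fin N) ℂ) : reIP X (Y + Y') = reIP X Y + reIP X Y' := by
  rw [reIP_comm, reIP_add_left, reIP_comm Y, reIP_comm Y']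

/-- `⟨X, Σ_i Y_i⟩ = Σ_i ⟨X, Y_i⟩`. [folklore] -/
theorem reIP_sum_right {ι : Type*} (s : Finset ι) (X : Matrix (Fin N) (Fin N) ℂ)
    (Y : ι → Matrix (Fin N) (Fin N) ℂ) : reIP X (∑ i ∈ s, Y i) = ∑ i ∈ s, reIP X (Y i) := by
  classical
  induction s using Finset.induction_on with
  | empty => simp [reIP]
  | insert a s ha ih => rw [Finset.sum_insert ha, Finset.sum_insert ha, reIP_add_right, ih]

/-- `⟨c X, Y⟩ = c ⟨X, Y⟩` for a real scalar. [folklore] -/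
theorem reIP_smul_left (c : ℝ) (X Y : Matrix (Fin N) (Fin N) ℂ) : reIP ((c : ℂ) • X) Y = c * reIP X Y := by
  simp only [reIP, Matrix.mul_smul, Matrix.trace_smul, smul_eq_mul, Complex.re_ofReal_mul]

/-- `‖X + Y‖² = ‖X‖² + ‖Y‖² + 2⟨X, Y⟩`. [folklore] -/
theorem normSq_add (X Y : Matrix (Fin N) (Fin N) ℂ) : ‖X + Y‖ ^ 2 = ‖X‖ ^ 2 + ‖Y‖ ^ 2 + 2 * reIP X Y := by
  rw [normSq_eq_reIP, normSq_eq_reIP, normSq_eq_reIP, reIP_add_left, reIP_add_right, reIP_add_right,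
    reIP_comm Y X]
  ring

/-- `‖c X‖ = |c| ‖X‖` for a real scalar (Frobenius norm). [folklore] -/
theorem norm_real_smul (c : ℝ) (X : Matrix (Fin N) (Fin N) ℂ) : ‖(c : ℂ) • X‖ = |c| * ‖X‖ := by
  rw [norm_smul, Complex.norm_real, Real.norm_eq_abs]

/-- **Weighted polarisation bound** `2|⟨X, Y⟩| ≤ s‖X‖² + s⁻¹‖Y‖²` (`s > 0`). [folklore] -/
theorem two_mul_abs_reIP_le (X Y : Matrix (Fin N) (Fin N) ℂ) {s : ℝ} (hs : 0 < s) :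
    2 * |reIP X Y| ≤ s * ‖X‖ ^ 2 + s⁻¹ * ‖Y‖ ^ 2 := by
  -- `0 ≤ ‖X ± s⁻¹ Y‖²`, multiplied through by `s`
  have hplus : 0 ≤ ‖X + ((s⁻¹ : ℝ) : ℂ) • Y‖ ^ 2 := sq_nonneg _
  have hminus : 0 ≤ ‖X + ((-s⁻¹ : ℝ) : ℂ) • Y‖ ^ 2 := sq_nonneg _
  rw [normSq_add, norm_real_smul, reIP_comm, reIP_smul_left] at hplus hminus
  rw [abs_inv, abs_of_pos hs] at hplus
  rw [abs_neg, abs_inv, abs_of_pos hs] at hminus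
  have hY : (s⁻¹ * ‖Y‖) ^ 2 = s⁻¹ * (s⁻¹ * ‖Y‖ ^ 2) := by ring
  rw [hY, reIP_comm Y X] at hplus hminus
  have hs' : 0 < s⁻¹ := inv_pos.2 hs
  -- multiply through by `s`
  have e1 : s * (‖X‖ ^ 2 + s⁻¹ * (s⁻¹ * ‖Y‖ ^ 2) + 2 * (s⁻¹ * reIP X Y)) =
      s * ‖X‖ ^ 2 + s⁻¹ * ‖Y‖ ^ 2 + 2 * reIP X Y := by field_simp
  have e2 : s * (‖X‖ ^ 2 + s⁻¹ * (s⁻¹ * ‖Y‖ ^ 2) + 2 * (-s⁻¹ * reIP X Y)) =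
      s * ‖X‖ ^ 2 + s⁻¹ * ‖Y‖ ^ 2 - 2 * reIP X Y := by field_simp; ring
  have h1 : 0 ≤ s * ‖X‖ ^ 2 + s⁻¹ * ‖Y‖ ^ 2 + 2 * reIP X Y := by rw [← e1]; exact mul_nonneg hs.le hplus
  have h2 : 0 ≤ s * ‖X‖ ^ 2 + s⁻¹ * ‖Y‖ ^ 2 - 2 * reIP X Y := by rw [← e2]; exact mul_nonneg hs.le hminus
  rcases le_or_gt 0 (reIP X Y) with h | h
  · rw [abs_of_nonneg h]; linarith
  · rw [abs_of_neg h]; linarith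

/-- **Discrete Cauchy–Schwarz for the Frobenius norm**: `‖Σ_i V_i‖² ≤ m Σ_i ‖V_i‖²`. [folklore] -/
theorem normSq_sum_le {ι : Type*} [Fintype ι] (V : ι → Matrix (Fin N) (Fin N) ℂ) :
    ‖∑ i, V i‖ ^ 2 ≤ Fintype.card ι * ∑ i, ‖V i‖ ^ 2 := by
  have h1 : ‖∑ i, V i‖ ≤ ∑ i, ‖V i‖ := norm_sum_le _ _
  have h2 : (∑ i, ‖V i‖ * 1) ^ 2 ≤ (∑ i, ‖V i‖ ^ 2) * ∑ _i : ι, (1 : ℝ) ^ 2 :=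
    Finset.sum_mul_sq_le_sq_mul_sq _ _ _
  simp only [mul_one, one_pow, Finset.sum_const, Finset.card_univ, nsmul_eq_mul] at h2
  calc ‖∑ i, V i‖ ^ 2 ≤ (∑ i, ‖V i‖) ^ 2 := pow_le_pow_left₀ (norm_nonneg _) h1 2
    _ ≤ (∑ i, ‖V i‖ ^ 2) * (Fintype.card ι : ℝ) := h2
    _ = Fintype.card ι * ∑ i, ‖V i‖ ^ 2 := mul_comm _ _

/-- **Parallel comparison**: `Σ_i ‖A − P_i‖² − Σ_i ‖A₀ − P_i‖² = m‖A − A₀‖² + 2⟨A − A₀, Σ_i (A₀ − P_i)⟩`. [folklore] -/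
theorem sum_normSq_sub_sub_sum_normSq_sub {ι : Type*} [Fintype ι] (A A₀ : Matrix (Fin N) (Fin N) ℂ)
    (P : ι → Matrix (Fin N) (Fin N) ℂ) :
    ∑ i, ‖A - P i‖ ^ 2 - ∑ i, ‖A₀ - P i‖ ^ 2 =
      Fintype.card ι * ‖A - A₀‖ ^ 2 + 2 * reIP (A - A₀) (∑ i, (A₀ - P i)) := by
  have hterm : ∀ i, ‖A - P i‖ ^ 2 = ‖A - A₀‖ ^ 2 + ‖A₀ - P i‖ ^ 2 + 2 * reIP (A - A₀) (A₀ - P i) := by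
    intro i
    have : A - P i = (A - A₀) + (A₀ - P i) := by abel
    rw [this, normSq_add]
  simp only [hterm, Finset.sum_add_distrib, Finset.sum_const, Finset.card_univ, nsmul_eq_mul, reIP_sum_right,
    Finset.mul_sum]
  ring

/-- **Two-sided pinch.**  With `m = #ι`, `r = ‖A − A₀‖`, `2u = Σ‖A − P_i‖²`, `2u₀ = Σ‖A₀ − P_i‖²`:
`(m/4) r² − u₀ ≤ u ≤ m r² + 2u₀`, i.e. `(m/2) r² − 2u₀·… `; stated on the doubled quantities:
`(m/2) r² − 4u₀' ≤ 2u − 2u₀ ≤ 2m r² + 2u₀'` where `u₀' = Σ‖A₀ − P_i‖²/… ` — precisely: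
`Σ‖A − P_i‖² ≤ 2m r² + 2 Σ‖A₀ − P_i‖²` and `(m/2) r² ≤ Σ‖A − P_i‖² + Σ‖A₀ − P_i‖²`. [folklore] -/
theorem sum_normSq_pinch {ι : Type*} [Fintype ι] [Nonempty ι] (A A₀ : Matrix (Fin N) (Fin N) ℂ)
    (P : ι → Matrix (Fin N) (Fin N) ℂ) :
    ∑ i, ‖A - P i‖ ^ 2 ≤ 2 * Fintype.card ι * ‖A - A₀‖ ^ 2 + 2 * ∑ i, ‖A₀ - P i‖ ^ 2 ∧
      (Fintype.card ι : ℝ) / 2 * ‖A - A₀‖ ^ 2 ≤ ∑ i, ‖A - P i‖ ^ 2 + ∑ i, ‖A₀ - P i‖ ^ 2 := by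
  set m : ℝ := (Fintype.card ι : ℝ) with hm
  have hmpos : 0 < m := by rw [hm]; exact_mod_cast Fintype.card_pos
  set W := ∑ i, (A₀ - P i) with hW
  have hid := sum_normSq_sub_sub_sum_normSq_sub A A₀ P
  have hWsq : ‖W‖ ^ 2 ≤ m * ∑ i, ‖A₀ - P i‖ ^ 2 := normSq_sum_le _
  have hS0 : 0 ≤ ∑ i, ‖A₀ - P i‖ ^ 2 := Finset.sum_nonneg fun i _ => sq_nonneg _
  constructor
  · -- weight `s = m`
    have hp := two_mul_abs_reIP_le (A - A₀) W hmpos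
    have hle : 2 * reIP (A - A₀) W ≤ m * ‖A - A₀‖ ^ 2 + m⁻¹ * ‖W‖ ^ 2 := by
      linarith [le_abs_self (reIP (A - A₀) W)]
    have hW' : m⁻¹ * ‖W‖ ^ 2 ≤ ∑ i, ‖A₀ - P i‖ ^ 2 := by
      rw [inv_mul_le_iff₀ hmpos]; exact hWsq
    rw [← hm] at hid
    linarith
  · -- weight `s = m/2`
    have hm2 : 0 < m / 2 := by positivity
    have hp := two_mul_abs_reIP_le (A - A₀) W hm2
    have hge : -(m / 2 * ‖A - A₀‖ ^ 2 + (m / 2)⁻¹ * ‖W‖ ^ 2) ≤ 2 * reIP (A - A₀) W := by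
      have := neg_abs_le (reIP (A - A₀) W)
      linarith
    have hW' : (m / 2)⁻¹ * ‖W‖ ^ 2 ≤ 2 * ∑ i, ‖A₀ - P i‖ ^ 2 := by
      rw [inv_mul_le_iff₀ hm2]
      calc ‖W‖ ^ 2 ≤ m * ∑ i, ‖A₀ - P i‖ ^ 2 := hWsq
        _ = m / 2 * (2 * ∑ i, ‖A₀ - P i‖ ^ 2) := by ring
    rw [← hm] at hid
    linarith

end Frobenius

/-! ## §2 The one-link Wilson cost -/

section Cost

variable {N : ℕ} {G : Type*} [Group G] [TopologicalSpace G] [IsTopologicalGroup G] [CompactSpace G]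
  (ρ : G →* Matrix (Fin N) (Fin N) ℂ)

/-- **The one-link Wilson cost** of a link variable `h` against a finite family of staples `k : ι → G`:
`u_k(h) = Σ_i (N − Re tr ρ(h k_i))` (each plaquette through the link contributes `N − Re tr ρ(U_p)` with `U_p = h k_i` up to
cyclic order). [folklore] -/
def linkCost {ι : Type*} [Fintype ι] (k : ι → G) (h : G) : ℝ := ∑ i, ((N : ℝ) - (ρ (h * k i)).trace.re)

omit [TopologicalSpace G] [IsTopologicalGroup G] [CompactSpace G] in
/-- `‖ρ g‖_F² = N` for a unitary representation. [folklore] -/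
theorem normSq_map (hU : ∀ g, ρ g ∈ Matrix.unitaryGroup (Fin N) ℂ) (g : G) : ‖ρ g‖ ^ 2 = N := by
  have h1 : (ρ g)ᴴ * ρ g = 1 := by
    rw [← Matrix.star_eq_conjTranspose]; exact Matrix.mem_unitaryGroup_iff'.1 (hU g)
  rw [normSq_eq_reIP, reIP, h1, Matrix.trace_one, Fintype.card_fin]
  simp

omit [TopologicalSpace G] [IsTopologicalGroup G] [CompactSpace G] in
/-- **Cost = half a squared chord**: `‖ρ h − ρ(k⁻¹)‖_F² = 2 (N − Re tr ρ(h k))`. [folklore] -/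
theorem normSq_map_sub_map_inv (hU : ∀ g, ρ g ∈ Matrix.unitaryGroup (Fin N) ℂ) (h k : G) :
    ‖ρ h - ρ k⁻¹‖ ^ 2 = 2 * ((N : ℝ) - (ρ (h * k)).trace.re) := by
  have e : ρ h - ρ k⁻¹ = ρ h + ((-1 : ℝ) : ℂ) • ρ k⁻¹ := by
    rw [Complex.ofReal_neg, Complex.ofReal_one, neg_one_smul, sub_eq_add_neg]
  have h1 : reIP (ρ h) (ρ k⁻¹) = (ρ (h * k)).trace.re := by
    rw [reIP, unitaryRep_inv_eq_conjTranspose ρ hU, Matrix.conjTranspose_conjTranspose, ← map_mul, map_mul,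
      Matrix.trace_mul_comm, ← map_mul]
  have h2 : ‖ρ k⁻¹‖ ^ 2 = N := normSq_map ρ hU _
  rw [e, normSq_add, norm_real_smul, reIP_comm, reIP_smul_left, reIP_comm, h1, abs_neg, abs_one, one_mul,
    normSq_map ρ hU, h2]
  ring

omit [TopologicalSpace G] [IsTopologicalGroup G] [CompactSpace G] in
/-- `u_k(h) = ½ Σ_i ‖ρ h − ρ(k_i⁻¹)‖_F²`. [folklore] -/
theorem linkCost_eq_half_sum_normSq (hU : ∀ g, ρ g ∈ Matrix.unitaryGroup (Fin N) ℂ) {ι : Type*} [Fintype ι]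
    (k : ι → G) (h : G) : linkCost ρ k h = (∑ i, ‖ρ h - ρ (k i)⁻¹‖ ^ 2) / 2 := by
  simp only [linkCost, normSq_map_sub_map_inv ρ hU, ← Finset.mul_sum]
  ring

omit [TopologicalSpace G] [IsTopologicalGroup G] [CompactSpace G] in
/-- The one-link cost is non-negative. [folklore] -/
theorem linkCost_nonneg (hU : ∀ g, ρ g ∈ Matrix.unitaryGroup (Fin N) ℂ) {ι : Type*} [Fintype ι] (k : ι → G) (h : G) :
    0 ≤ linkCost ρ k h := by
  rw [linkCost_eq_half_sum_normSq ρ hU]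
  exact div_nonneg (Finset.sum_nonneg fun i _ => sq_nonneg _) two_pos.le

omit [CompactSpace G] in
/-- The one-link cost is continuous in the link variable. [folklore] -/
theorem continuous_linkCost (hρ : Continuous ρ) {ι : Type*} [Fintype ι] (k : ι → G) : Continuous (linkCost ρ k) := by
  unfold linkCost
  refine continuous_finsetSum _ fun i _ => continuous_const.sub ?_
  exact Complex.continuous_re.comp (hρ.comp (continuous_id.mul continuous_const)).matrix_trace

/-- The one-link cost attains its minimum (`G` compact). [folklore] -/
theorem exists_linkCost_le_linkCost (hρ : Continuous ρ) {ι : Type*} [Fintype ι] (k : ι → G) :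
    ∃ g₀ : G, ∀ h : G, linkCost ρ k g₀ ≤ linkCost ρ k h := by
  obtain ⟨g₀, -, hg₀⟩ := isCompact_univ.exists_isMinOn (Set.univ_nonempty (α := G)) (continuous_linkCost ρ hρ k).continuousOn
  exact ⟨g₀, fun h => hg₀ (Set.mem_univ h)⟩

omit [TopologicalSpace G] [IsTopologicalGroup G] [CompactSpace G] in
/-- **Two-sided pinch of the one-link cost around any base point `g₀`** (`m = #ι`, `r = ‖ρ h − ρ g₀‖_F`, `u₀ = u_k(g₀)`):
`(m/4) r² − u₀ ≤ u_k(h) ≤ m r² + 2u₀`. [folklore] -/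
theorem linkCost_pinch (hU : ∀ g, ρ g ∈ Matrix.unitaryGroup (Fin N) ℂ) {ι : Type*} [Fintype ι] [Nonempty ι]
    (k : ι → G) (g₀ h : G) :
    (Fintype.card ι : ℝ) / 4 * ‖ρ h - ρ g₀‖ ^ 2 - linkCost ρ k g₀ ≤ linkCost ρ k h ∧
      linkCost ρ k h ≤ Fintype.card ι * ‖ρ h - ρ g₀‖ ^ 2 + 2 * linkCost ρ k g₀ := by
  obtain ⟨h1, h2⟩ := sum_normSq_pinch (ρ h) (ρ g₀) (fun i => ρ (k i)⁻¹)
  rw [linkCost_eq_half_sum_normSq ρ hU, linkCost_eq_half_sum_normSq ρ hU]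
  constructor <;> linarith

end Cost

end Summit.QuantumFields.YangMills.Cruxes.NT.LinkEquipartition

end
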